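import Summits.KontsevichZagierPeriods.KontsevichZagierPeriods.Theorems.HurwitzMicroSectorsNormalFormPrincipleM2FiveZetaTwo

/-!
# `NormalFormPrinciple` (stmt-KontsevichZagierPeriods-3869), line `SketchIdeator1` — leaf `stub_boxRigidity`,
# dimension two off the product type (`CatalanTwoWays`, disc side): the disc product rule

Registered sub-goal `disc_logMonomial_mul` of the layer `CatalanTwoWays` (lead file `…CatalanDisc`).
Write `σ = {0 < x < 1} ⊆ ℝ¹`, `a = a(x) = √(2 − x²) ∈ (1, √2)` for `x ∈ (0,1)`, and, for an edge
`v ≥ 1` on `σ`, `M(v) = [{x ∈ σ, 1 ≤ s ≤ v x}, (1/(2a))/s]` for any integral representation with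
this band as domain and this integrand on it (the unfolded log monomial `∫₀¹ log v(x) dx/(2a)`).
We record: the `ℚ`-semialgebraicity on `σ` of the weight `1/(2a)` and of the three edges `1 + 1/a`,
`a/(a − 1)`, `(a + 1)/(a − 1)` (closure of semialgebraic functions under `+, −, ·, ⁻¹, √`,
Bochnak–Coste–Roy Prop. 2.2.6); the bounds `1 < a < √2` and `edge ≥ 1` on `(0,1)`; and the unfolded
product rule `M((a+1)/(a−1)) − M(1 + 1/a) − M(a/(a−1)) ∈ relations`
(`KZ.of_sub_of_sub_mem_relations_mul`: rule 1a, splitting the band at `s = 1 + 1/a`, and rule 2,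
the substitution `s = (1 + 1/a) s'`), the product band `{1 ≤ s ≤ (1 + 1/a) · a/(a−1)}` being
identified with the stated one through the pointwise identity `(1 + 1/a) · a/(a−1) = (a+1)/(a−1)`
on `σ` (`KZlog.band_congr`).
References: M. Kontsevich, D. Zagier, *Periods* (2001), §1.2, rules (1), (2). No new definitions.
-/

noncomputable section

open MeasureTheory Set
open Literature.NumberTheory.Transcendental Literature.NumberTheory.Transcendental.KZ
open Literature.ModelTheory.ExponentialFields (IsSemialgebraic)

namespace Summit.KontsevichZagierPeriods.HurwitzMicroSectors.NormalFormPrinciple.PiBox.M2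

/-- On `(0,1)`: `1 < √(2 − x²) < √2`. [folklore] -/
private theorem discMul_sqrt_bounds {x : ℝ} (hx : x ∈ Set.Ioo (0:ℝ) 1) :
    1 < Real.sqrt (2 - x ^ 2) ∧ Real.sqrt (2 - x ^ 2) < Real.sqrt 2 := by
  have hx2 : x ^ 2 < 1 := pow_lt_one₀ hx.1.le hx.2 two_ne_zero
  have hx2' : 0 < x ^ 2 := pow_pos hx.1 2
  refine ⟨(Real.lt_sqrt zero_le_one).2 (by linarith), Real.sqrt_lt_sqrt (by linarith) (by linarith)⟩

/-- On `σ = (0,1) ⊆ ℝ¹`: `1 < √(2 − x²)`. [folklore] -/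
private theorem discMul_one_lt_sqrt {y : Fin 1 → ℝ} (hy : y ∈ {y : Fin 1 → ℝ | 0 < y 0 ∧ y 0 < 1}) :
    1 < Real.sqrt (2 - y 0 ^ 2) :=
  (discMul_sqrt_bounds (x := y 0) hy).1

/-- `√(2 − x²)` is `ℚ`-semialgebraic on `σ = (0,1) ⊆ ℝ¹` (square root of a polynomial).
[folklore] -/
private theorem discMul_isSemialgebraicFunOn_sqrt :
    IsSemialgebraicFunOn ℚ {y : Fin 1 → ℝ | 0 < y 0 ∧ y 0 < 1}
      (fun y => Real.sqrt (2 - y 0 ^ 2)) :=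
  IsSemialgebraicFunOn.sqrt_holds
    ((isSemialgebraicFunOn_aeval isSemialgebraic_unitInterval_fin_one
      (2 - MvPolynomial.X 0 ^ 2 : MvPolynomial (Fin 1) ℚ)).congr fun x _ => by simp)

/-- The weight `1/(2√(2 − x²))` is `ℚ`-semialgebraic on `σ = (0,1) ⊆ ℝ¹`. [folklore] -/
private theorem discMul_isSemialgebraicFunOn_weight :
    IsSemialgebraicFunOn ℚ {y : Fin 1 → ℝ | 0 < y 0 ∧ y 0 < 1}
      (fun y => 1 / (2 * Real.sqrt (2 - y 0 ^ 2))) := by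
  have h2a : IsSemialgebraicFunOn ℚ {y : Fin 1 → ℝ | 0 < y 0 ∧ y 0 < 1}
      (fun y => 2 * Real.sqrt (2 - y 0 ^ 2)) :=
    (IsSemialgebraicFunOn.mul_holds (isSemialgebraicFunOn_ratCast
      isSemialgebraic_unitInterval_fin_one 2) discMul_isSemialgebraicFunOn_sqrt).congr
      fun y _ => by simp
  refine ((isSemialgebraicFunOn_ratCast isSemialgebraic_unitInterval_fin_one 1).div h2a
    fun y hy => ?_).congr fun y _ => by simp
  have := discMul_one_lt_sqrt hy
  positivity

/-- The edge `1 + 1/√(2 − x²)` is `ℚ`-semialgebraic on `σ = (0,1) ⊆ ℝ¹`. [folklore] -/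
private theorem discMul_isSemialgebraicFunOn_plusEdge :
    IsSemialgebraicFunOn ℚ {y : Fin 1 → ℝ | 0 < y 0 ∧ y 0 < 1}
      (fun y => 1 + 1 / Real.sqrt (2 - y 0 ^ 2)) := by
  have hinv : IsSemialgebraicFunOn ℚ {y : Fin 1 → ℝ | 0 < y 0 ∧ y 0 < 1}
      (fun y => 1 / Real.sqrt (2 - y 0 ^ 2)) := by
    refine ((isSemialgebraicFunOn_ratCast isSemialgebraic_unitInterval_fin_one 1).div
      discMul_isSemialgebraicFunOn_sqrt fun y hy => ?_).congr fun y _ => by simp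
    have := discMul_one_lt_sqrt hy
    positivity
  exact (IsSemialgebraicFunOn.add_holds
    (isSemialgebraicFunOn_ratCast isSemialgebraic_unitInterval_fin_one 1) hinv).congr
    fun y _ => by simp

/-- The edge `√(2 − x²)/(√(2 − x²) − 1)` is `ℚ`-semialgebraic on `σ = (0,1) ⊆ ℝ¹` (the
denominator is positive there). [folklore] -/
private theorem discMul_isSemialgebraicFunOn_minusEdge :
    IsSemialgebraicFunOn ℚ {y : Fin 1 → ℝ | 0 < y 0 ∧ y 0 < 1}
      (fun y => Real.sqrt (2 - y 0 ^ 2) / (Real.sqrt (2 - y 0 ^ 2) - 1)) := by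
  have hden : IsSemialgebraicFunOn ℚ {y : Fin 1 → ℝ | 0 < y 0 ∧ y 0 < 1}
      (fun y => Real.sqrt (2 - y 0 ^ 2) - 1) :=
    (IsSemialgebraicFunOn.sub_holds discMul_isSemialgebraicFunOn_sqrt
      (isSemialgebraicFunOn_ratCast isSemialgebraic_unitInterval_fin_one 1)).congr
      fun y _ => by simp
  exact discMul_isSemialgebraicFunOn_sqrt.div hden fun y hy =>
    (sub_pos.2 (discMul_one_lt_sqrt hy)).ne'

/-- The edge `(√(2 − x²) + 1)/(√(2 − x²) − 1)` is `ℚ`-semialgebraic on `σ = (0,1) ⊆ ℝ¹` (the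
denominator is positive there). [folklore] -/
private theorem discMul_isSemialgebraicFunOn_edge :
    IsSemialgebraicFunOn ℚ {y : Fin 1 → ℝ | 0 < y 0 ∧ y 0 < 1}
      (fun y => (Real.sqrt (2 - y 0 ^ 2) + 1) / (Real.sqrt (2 - y 0 ^ 2) - 1)) := by
  have hden : IsSemialgebraicFunOn ℚ {y : Fin 1 → ℝ | 0 < y 0 ∧ y 0 < 1}
      (fun y => Real.sqrt (2 - y 0 ^ 2) - 1) :=
    (IsSemialgebraicFunOn.sub_holds discMul_isSemialgebraicFunOn_sqrt
      (isSemialgebraicFunOn_ratCast isSemialgebraic_unitInterval_fin_one 1)).congr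
      fun y _ => by simp
  have hnum : IsSemialgebraicFunOn ℚ {y : Fin 1 → ℝ | 0 < y 0 ∧ y 0 < 1}
      (fun y => Real.sqrt (2 - y 0 ^ 2) + 1) :=
    (IsSemialgebraicFunOn.add_holds discMul_isSemialgebraicFunOn_sqrt
      (isSemialgebraicFunOn_ratCast isSemialgebraic_unitInterval_fin_one 1)).congr
      fun y _ => by simp
  exact hnum.div hden fun y hy => (sub_pos.2 (discMul_one_lt_sqrt hy)).ne'

/-- On `(0,1)`, with `a = √(2 − x²)`: `1 < a < √2` and the three edges `1 + 1/a`, `a/(a − 1)`,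
`(a + 1)/(a − 1)` are `≥ 1`. [folklore] -/
private theorem discMul_edges_one_le {x : ℝ} (hx : x ∈ Set.Ioo (0:ℝ) 1) :
    1 < Real.sqrt (2 - x ^ 2) ∧ Real.sqrt (2 - x ^ 2) < Real.sqrt 2 ∧
      1 ≤ 1 + 1 / Real.sqrt (2 - x ^ 2) ∧
      1 ≤ Real.sqrt (2 - x ^ 2) / (Real.sqrt (2 - x ^ 2) - 1) ∧
      1 ≤ (Real.sqrt (2 - x ^ 2) + 1) / (Real.sqrt (2 - x ^ 2) - 1) := by
  obtain ⟨h1, h2⟩ := discMul_sqrt_bounds hx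
  have hpos : 0 < Real.sqrt (2 - x ^ 2) - 1 := sub_pos.2 h1
  refine ⟨h1, h2, le_add_of_nonneg_right (by positivity), ?_, ?_⟩
  · rw [one_le_div hpos]
    linarith
  · rw [one_le_div hpos]
    linarith

/-- **The disc product rule (rules 1a + 2).** With `a = √(2 − x²)` and
`M(v) = [{0 < x < 1, 1 ≤ s ≤ v x}, (1/(2a))/s]` (any representation with this band as domain and
this integrand on it): `M((a+1)/(a−1)) − M(1 + 1/a) − M(a/(a−1)) ∈ relations`, an instance of the
unfolded product rule `log (u w) = log u + log w` (`KZ.of_sub_of_sub_mem_relations_mul`), since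
`(1 + 1/a) · a/(a − 1) = (a + 1)/(a − 1)` on `(0,1)`. [cite: KontsevichZagier2001, §1.2] -/
theorem disc_logMonomial_mul_rel (J Mp Mm : IntegralRep 2)
    (hJd : J.domain = KZlog.band {y : Fin 1 → ℝ | 0 < y 0 ∧ y 0 < 1} (fun _ => (1:ℝ))
      (fun y => (Real.sqrt (2 - y 0 ^ 2) + 1) / (Real.sqrt (2 - y 0 ^ 2) - 1)))
    (hJi : EqOn J.integrand (fun z => (1 / (2 * Real.sqrt (2 - z 0 ^ 2))) / z 1) J.domain)
    (hMpd : Mp.domain = KZlog.band {y : Fin 1 → ℝ | 0 < y 0 ∧ y 0 < 1} (fun _ => (1:ℝ))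
      (fun y => 1 + 1 / Real.sqrt (2 - y 0 ^ 2)))
    (hMpi : EqOn Mp.integrand (fun z => (1 / (2 * Real.sqrt (2 - z 0 ^ 2))) / z 1) Mp.domain)
    (hMmd : Mm.domain = KZlog.band {y : Fin 1 → ℝ | 0 < y 0 ∧ y 0 < 1} (fun _ => (1:ℝ))
      (fun y => Real.sqrt (2 - y 0 ^ 2) / (Real.sqrt (2 - y 0 ^ 2) - 1)))
    (hMmi : EqOn Mm.integrand (fun z => (1 / (2 * Real.sqrt (2 - z 0 ^ 2))) / z 1) Mm.domain) :
    of J - of Mp - of Mm ∈ relations := by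
  have hv : EqOn (fun y : Fin 1 → ℝ => (Real.sqrt (2 - y 0 ^ 2) + 1) / (Real.sqrt (2 - y 0 ^ 2) - 1))
      (fun y => (1 + 1 / Real.sqrt (2 - y 0 ^ 2)) *
        (Real.sqrt (2 - y 0 ^ 2) / (Real.sqrt (2 - y 0 ^ 2) - 1)))
      {y : Fin 1 → ℝ | 0 < y 0 ∧ y 0 < 1} := fun y hy => by
    have h1 := discMul_one_lt_sqrt hy
    have ha0 : Real.sqrt (2 - y 0 ^ 2) ≠ 0 := by positivity
    have ha1 : Real.sqrt (2 - y 0 ^ 2) - 1 ≠ 0 := (sub_pos.2 h1).ne'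
    simp only
    field_simp
  exact KZ.of_sub_of_sub_mem_relations_mul (m := 1)
    (g := fun y => 1 / (2 * Real.sqrt (2 - y 0 ^ 2)))
    (u := fun y => 1 + 1 / Real.sqrt (2 - y 0 ^ 2))
    (w := fun y => Real.sqrt (2 - y 0 ^ 2) / (Real.sqrt (2 - y 0 ^ 2) - 1))
    isSemialgebraic_unitInterval_fin_one discMul_isSemialgebraicFunOn_plusEdge
    discMul_isSemialgebraicFunOn_minusEdge
    (fun y hy => (discMul_edges_one_le (x := y 0) hy).2.2.1)
    (fun y hy => (discMul_edges_one_le (x := y 0) hy).2.2.2.1) J Mp Mm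
    (hJd.trans (KZlog.band_congr hv)) hJi hMpd hMpi hMmd hMmi

/-- **Stub (disc product rule + the semialgebraic data of the disc side).** With `a = √(2 − x²)`:
the weight `1/(2a)` and the edges `1 + 1/a`, `a/(a−1)`, `(a+1)/(a−1)` are `ℚ`-semialgebraic on
`σ = (0,1) ⊆ ℝ¹`; on `(0,1)` one has `1 < a < √2` and the three edges are `≥ 1`; and for
`M(v) = [{0 < x < 1, 1 ≤ s ≤ v x}, (1/(2a))/s]` the unfolded product rule
`M((a+1)/(a−1)) − M(1 + 1/a) − M(a/(a−1)) ∈ relations` holds (rules 1a + 2 of the KZ calculus).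
[cite: KontsevichZagier2001, §1.2] -/
theorem disc_logMonomial_mul :
    IsSemialgebraicFunOn ℚ {y : Fin 1 → ℝ | 0 < y 0 ∧ y 0 < 1}
      (fun y => (fun x : ℝ => 1 / (2 * Real.sqrt (2 - x ^ 2))) (y 0)) ∧
    IsSemialgebraicFunOn ℚ {y : Fin 1 → ℝ | 0 < y 0 ∧ y 0 < 1}
      (fun y => (fun x : ℝ => 1 + 1 / Real.sqrt (2 - x ^ 2)) (y 0)) ∧
    IsSemialgebraicFunOn ℚ {y : Fin 1 → ℝ | 0 < y 0 ∧ y 0 < 1}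
      (fun y => (fun x : ℝ => Real.sqrt (2 - x ^ 2) / (Real.sqrt (2 - x ^ 2) - 1)) (y 0)) ∧
    IsSemialgebraicFunOn ℚ {y : Fin 1 → ℝ | 0 < y 0 ∧ y 0 < 1}
      (fun y => (fun x : ℝ => (Real.sqrt (2 - x ^ 2) + 1) / (Real.sqrt (2 - x ^ 2) - 1)) (y 0)) ∧
    (∀ x ∈ Set.Ioo (0:ℝ) 1, 1 < Real.sqrt (2 - x ^ 2) ∧ Real.sqrt (2 - x ^ 2) < Real.sqrt 2 ∧
      1 ≤ 1 + 1 / Real.sqrt (2 - x ^ 2) ∧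
      1 ≤ Real.sqrt (2 - x ^ 2) / (Real.sqrt (2 - x ^ 2) - 1) ∧
      1 ≤ (Real.sqrt (2 - x ^ 2) + 1) / (Real.sqrt (2 - x ^ 2) - 1)) ∧
    (∀ (J Mp Mm : IntegralRep 2),
      J.domain = KZlog.band {y : Fin 1 → ℝ | 0 < y 0 ∧ y 0 < 1} (fun _ => (1:ℝ))
        (fun y => (Real.sqrt (2 - y 0 ^ 2) + 1) / (Real.sqrt (2 - y 0 ^ 2) - 1)) →
      EqOn J.integrand (fun z => (1 / (2 * Real.sqrt (2 - z 0 ^ 2))) / z 1) J.domain →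
      Mp.domain = KZlog.band {y : Fin 1 → ℝ | 0 < y 0 ∧ y 0 < 1} (fun _ => (1:ℝ))
        (fun y => 1 + 1 / Real.sqrt (2 - y 0 ^ 2)) →
      EqOn Mp.integrand (fun z => (1 / (2 * Real.sqrt (2 - z 0 ^ 2))) / z 1) Mp.domain →
      Mm.domain = KZlog.band {y : Fin 1 → ℝ | 0 < y 0 ∧ y 0 < 1} (fun _ => (1:ℝ))
        (fun y => Real.sqrt (2 - y 0 ^ 2) / (Real.sqrt (2 - y 0 ^ 2) - 1)) →
      EqOn Mm.integrand (fun z => (1 / (2 * Real.sqrt (2 - z 0 ^ 2))) / z 1) Mm.domain →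
      of J - of Mp - of Mm ∈ relations) :=
  ⟨discMul_isSemialgebraicFunOn_weight, discMul_isSemialgebraicFunOn_plusEdge,
    discMul_isSemialgebraicFunOn_minusEdge, discMul_isSemialgebraicFunOn_edge,
    fun _ hx => discMul_edges_one_le hx, disc_logMonomial_mul_rel⟩

end Summit.KontsevichZagierPeriods.HurwitzMicroSectors.NormalFormPrinciple.PiBox.M2
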